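import Summits.Schanuel.Schanuel.Theorems.RootDecomp1ERadixCell03

/-!
# RootDecomp1ERadixCell — lens 2, generation 42 «THE FINITE-ORDER RADIX-2 CELL: count CONJUGATES, not degree» (lanes E-R19 (i) T below hyper + (iii) the transcendental weight log 2): S ITSELF on the pure-radix class {z_l = (v_l·log 2)·T^{e_l}, T real of FIXED finite exponential order} HYPOTHESIS-FREE and on the mixed radix class {z_l = (u_l + v_l log 2)·T^{e_l}} mod the ONE tree fact hX = ExplicitRatExpApprox — the Kummer-direction degree is paid by COUNTING the 𝔐 conjugates of 2^{1/𝔐} through the resultant norm Res_Y(Y^𝔐 − 2, F), never by a pair measure — continuation (RootDecomp1ERadixCell04): §4 integral exponents at the collapse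

(lens-2 g42 HOME kernel RadixCell.lean d9530aae…, 1851 l, imports tree RootDecomp1EUntwistedWall04 + RootDecomp1KFiniteOrderCell02 only; CLAIM L2067, ACK + CHECKLIST E-g42 L2069, NODE L2089 / REQUEST L2090, critic VERDICT L2095 (crit g8: CLEARED — ONE CELL, tiers 1+2 = one cell; lens-2 tally CELL ×4 (g37, g39, g41, g42); E-R20 closes the radix line; PORT GO `--supports stmt-Schanuel-31410`); port by census-1 gen 18 as `RootDecomp1ERadixCell01`–`08` along K's sections: 01 = §1 the radix field ℚ(2^{1/𝔐}) (`croot`, `zroot`, `broot`, `irreducible_X_pow_sub_two`, degree 𝔐); 02 = §2 the two-level polynomial, conjugate factors `Gfac`, the RESULTANT NORM `resNorm` (`map_resNorm` = ∏ conjugates, `resNorm_ne_zero`, degree / value / Mahler-measure bounds); 03 = §3 the radix curve point `radixPt`, germs, fibres, root and residue avoidance at transcendental parameters; 04 = §4 integral exponents at the collapse (`Mden`, `Aexp`, `Bexp`, the value of G₀, from avoidance to the hypotheses of `resNorm_ne_zero`); 05 = §5 THE PURE-RADIX ENGINE `algebraicIndependent_radixPt_pure` (hypothesis-free, `endgame_pure`)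 + §5b mixed-engine helpers; 06 = §5b THE MIXED ENGINE `algebraicIndependent_radixPt (hX)` (one 320-line theorem, scoped `maxHeartbeats 800000` carried as in K); 07 = §6 classes `InPureRadixClass` / `InRadixClass`, `schanuel_inPureRadixClass` (hyp-free) / `schanuel_inRadixClass (hX)`, cells `cell_31410(_pure)` / `cell_25020(_pure)`, members `zLog2Curve` / `zMix` at tower numbers; 08 = §6 items AT the members + separation (`zMix_not_inPointClass`, `zLog2Curve_not_inPointClass`, `zMix_separation`).
PORT EDITS: 37 one-line docstrings added; five generic helpers made `private` against dedup twins (`mahlerMeasure_finset_prod`, `eval_map_intCast`, `aeval_ne_zero_of_transcendental`, `addNat_eq_natAdd`, `transcendental_log_two` ≡ tree AclSubsetLogFreeCore/Negative) with per-part private copies; statements and proofs verbatim. `--supports stmt-Schanuel-31410`; no census credit carried; rung 0 — nothing here proves Schanuel.)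
-/

noncomputable section

open Complex Polynomial IntermediateField Filter
open scoped BigOperators Topology

namespace Summit.Schanuel.Schanuel.Theorems.RootDecomp1ERadixCell

open Summit.Schanuel.Schanuel.Theorems.RootDecomp1EUntwistedWall (gι gaussPt expo coef tail fib IsZ wden wden_pos
  isZ_expo Wb Wb_nonneg abs_expo_le abs_coef_le expo_eq_of_tail_eq sum_coef_fibre_cast fib_ne_zero diffPoly
  diffPoly_ne_zero eval_diffPoly gι_expo_sub gι_injective tail_eq_of_expo_eq eq_of_tail_eq_of_zero_eq coef_cast
  IsZ.add IsZ.mul IsZ.natCast IsZ.sum isZ_wden_fst isZ_wden_snd InGaussCurveClass)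
open Summit.Schanuel.Schanuel.Theorems.RootDecomp1EPointTransfer (InPointClass)
open Summit.Schanuel.Schanuel.Theorems.RootDecomp1ETwoScale (InTwoScaleClass)
open Summit.Schanuel.Schanuel.Theorems.RootDecomp1EWallDichotomy (InTwistedFrameClass)
open Summit.Schanuel.Schanuel.Theorems.RootDecomp1KHyper
open Summit.Schanuel.Schanuel.Theorems.RootDecomp1KHyper.HyperCell
open Summit.Schanuel.Schanuel.Theorems.RootDecomp1KGeneric (LiouvilleOrder)
open Summit.Schanuel.Schanuel.Theorems.RootDecomp1KFiniteOrderCell (towerNumber liouvilleOrder_towerNumber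
  not_hyperLiouville_towerNumber towerNumber_pos not_liouvilleOrder_towerNumber)
open Summit.Schanuel.Schanuel.Theorems.RootDecomp1BDefectFloorCells (natCast_le_trdeg_of_algebraicIndependent)

/-! ## §4  Integral exponents at the collapse: `𝔐 = wden·den(r)^{Σe}`, `A'_s, B'_s ∈ ℕ`, the value of `G₀` -/

section Collapse

variable {n : ℕ}

/-- A non-negative rational which is an integer is the cast of the natural number `num.toNat`. -/
theorem IsZ.natCast_toNat {x : ℚ} (h : IsZ x) (hx : 0 ≤ x) : ((x.num.toNat : ℕ) : ℚ) = x := by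
  obtain ⟨z, rfl⟩ := h
  have hz : 0 ≤ z := by exact_mod_cast hx
  rw [Rat.num_intCast]
  exact_mod_cast Int.toNat_of_nonneg hz

/-- THE COMMON DENOMINATOR `𝔐 = wden(w) · den(r)^{Σ_l e_l}` of the collapsed exponents. -/
def Mden (w : Fin n → ℚ × ℚ) (e : Fin n → ℕ) (r : ℚ) : ℕ := wden w * r.den ^ (∑ l, e l)

/-- `0 < 𝔐 = wden · den(r)^{Σe}`. -/
theorem Mden_pos (w : Fin n → ℚ × ℚ) (e : Fin n → ℕ) (r : ℚ) : 0 < Mden w e r :=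
  Nat.mul_pos (wden_pos w) (pow_pos r.den_pos _)

/-- `A'_s = 𝔐 · (expo_s).1 ∈ ℕ` (the exponent of `x = e^{1/𝔐}`). -/
def Aexp (w : Fin n → ℚ × ℚ) (e : Fin n → ℕ) (r : ℚ) (s : Fin (n + 1) →₀ ℕ) : ℕ :=
  (((Mden w e r : ℕ) : ℚ) * (expo w e r s).1).num.toNat

/-- `B'_s = 𝔐 · (expo_s).2 ∈ ℕ` (the exponent of the radix root `2^{1/𝔐}`). -/
def Bexp (w : Fin n → ℚ × ℚ) (e : Fin n → ℕ) (r : ℚ) (s : Fin (n + 1) →₀ ℕ) : ℕ :=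
  (((Mden w e r : ℕ) : ℚ) * (expo w e r s).2).num.toNat

/-- The first (rational) exponent part is nonnegative for nonnegative weights and `r ≥ 0`. -/
theorem expo_fst_nonneg {w : Fin n → ℚ × ℚ} (hu : ∀ l, 0 ≤ (w l).1) (e : Fin n → ℕ) {r : ℚ} (hr : 0 ≤ r)
    (s : Fin (n + 1) →₀ ℕ) : 0 ≤ (expo w e r s).1 :=
  Finset.sum_nonneg fun l _ => mul_nonneg (mul_nonneg (Nat.cast_nonneg _) (hu l)) (pow_nonneg hr _)

/-- The second (`log 2`) exponent part is nonnegative for nonnegative weights and `r ≥ 0`. -/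
theorem expo_snd_nonneg {w : Fin n → ℚ × ℚ} (hv : ∀ l, 0 ≤ (w l).2) (e : Fin n → ℕ) {r : ℚ} (hr : 0 ≤ r)
    (s : Fin (n + 1) →₀ ℕ) : 0 ≤ (expo w e r s).2 :=
  Finset.sum_nonneg fun l _ => mul_nonneg (mul_nonneg (Nat.cast_nonneg _) (hv l)) (pow_nonneg hr _)

/-- For a PURE radix datum (`u ≡ 0`) the first exponent part vanishes. -/
theorem expo_fst_eq_zero {w : Fin n → ℚ × ℚ} (hu : ∀ l, (w l).1 = 0) (e : Fin n → ℕ) (r : ℚ)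
    (s : Fin (n + 1) →₀ ℕ) : (expo w e r s).1 = 0 := by
  change (∑ l : Fin n, (s l.succ : ℚ) * (w l).1 * r ^ (e l)) = 0
  exact Finset.sum_eq_zero fun l _ => by rw [hu l, mul_zero, zero_mul]

/-- `A'_s = 𝔐 · (expo s).1` as rationals. -/
theorem Aexp_cast {w : Fin n → ℚ × ℚ} (hu : ∀ l, 0 ≤ (w l).1) (e : Fin n → ℕ) {r : ℚ} (hr : 0 ≤ r)
    (s : Fin (n + 1) →₀ ℕ) : ((Aexp w e r s : ℕ) : ℚ) = (Mden w e r : ℚ) * (expo w e r s).1 :=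
  IsZ.natCast_toNat (isZ_expo w e r s).1 (mul_nonneg (Nat.cast_nonneg _) (expo_fst_nonneg hu e hr s))

/-- `B'_s = 𝔐 · (expo s).2` as rationals. -/
theorem Bexp_cast {w : Fin n → ℚ × ℚ} (hv : ∀ l, 0 ≤ (w l).2) (e : Fin n → ℕ) {r : ℚ} (hr : 0 ≤ r)
    (s : Fin (n + 1) →₀ ℕ) : ((Bexp w e r s : ℕ) : ℚ) = (Mden w e r : ℚ) * (expo w e r s).2 :=
  IsZ.natCast_toNat (isZ_expo w e r s).2 (mul_nonneg (Nat.cast_nonneg _) (expo_snd_nonneg hv e hr s))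

/-- PURE RADIX data (`u ≡ 0`): every `A'_s = 0`. -/
theorem Aexp_eq_zero {w : Fin n → ℚ × ℚ} (hu : ∀ l, (w l).1 = 0) (e : Fin n → ℕ) (r : ℚ)
    (s : Fin (n + 1) →₀ ℕ) : Aexp w e r s = 0 := by
  rw [Aexp, expo_fst_eq_zero hu, mul_zero, Rat.num_zero, Int.toNat_zero]

/-- `(expo_s).1 = A'_s / 𝔐` in `ℝ`. -/
theorem expo_fst_real {w : Fin n → ℚ × ℚ} (hu : ∀ l, 0 ≤ (w l).1) (e : Fin n → ℕ) {r : ℚ} (hr : 0 ≤ r)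
    (s : Fin (n + 1) →₀ ℕ) : ((expo w e r s).1 : ℝ) = (Aexp w e r s : ℝ) * ((Mden w e r : ℕ) : ℝ)⁻¹ := by
  have hM : ((Mden w e r : ℕ) : ℝ) ≠ 0 := by exact_mod_cast (Mden_pos w e r).ne'
  have h := Aexp_cast hu e hr s
  have h' : ((Aexp w e r s : ℕ) : ℝ) = ((Mden w e r : ℕ) : ℝ) * ((expo w e r s).1 : ℝ) := by exact_mod_cast h
  rw [h']; field_simp

/-- `(expo_s).2 = B'_s / 𝔐` in `ℝ`. -/
theorem expo_snd_real {w : Fin n → ℚ × ℚ} (hv : ∀ l, 0 ≤ (w l).2) (e : Fin n → ℕ) {r : ℚ} (hr : 0 ≤ r)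
    (s : Fin (n + 1) →₀ ℕ) : ((expo w e r s).2 : ℝ) = (Bexp w e r s : ℝ) * ((Mden w e r : ℕ) : ℝ)⁻¹ := by
  have hM : ((Mden w e r : ℕ) : ℝ) ≠ 0 := by exact_mod_cast (Mden_pos w e r).ne'
  have h := Bexp_cast hv e hr s
  have h' : ((Bexp w e r s : ℕ) : ℝ) = ((Mden w e r : ℕ) : ℝ) * ((expo w e r s).2 : ℝ) := by exact_mod_cast h
  rw [h']; field_simp

/-- The radix power at the collapse: `c_𝔐^{B'_s} = 2^{(expo_s).2} = exp((expo_s).2 · log 2)`. -/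
theorem croot_pow_Bexp {w : Fin n → ℚ × ℚ} (hv : ∀ l, 0 ≤ (w l).2) (e : Fin n → ℕ) {r : ℚ} (hr : 0 ≤ r)
    (s : Fin (n + 1) →₀ ℕ) :
    croot (Mden w e r) ^ Bexp w e r s = Real.exp (((expo w e r s).2 : ℝ) * Real.log 2) := by
  rw [croot_pow_eq_exp, expo_snd_real hv e hr]
  congr 1; ring

/-- The `e`-power at the collapse: `x^{A'_s} = e^{(expo_s).1}` for `x = e^{1/𝔐}`. -/
theorem xroot_pow_Aexp {w : Fin n → ℚ × ℚ} (hu : ∀ l, 0 ≤ (w l).1) (e : Fin n → ℕ) {r : ℚ} (hr : 0 ≤ r)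
    (s : Fin (n + 1) →₀ ℕ) :
    Real.exp (((Mden w e r : ℕ) : ℝ)⁻¹) ^ Aexp w e r s = Real.exp ((expo w e r s).1 : ℝ) := by
  rw [← Real.exp_nat_mul, expo_fst_real hu e hr]

/-- **THE EXPONENTIAL AT THE COLLAPSE IS A MONOMIAL IN THE TWO ROOTS**:
`e^{ρ(expo_s)} = x^{A'_s} · c_𝔐^{B'_s}`, `x = e^{1/𝔐}`, `c_𝔐 = 2^{1/𝔐}`. -/
theorem exp_ρr_expo {w : Fin n → ℚ × ℚ} (hu : ∀ l, 0 ≤ (w l).1) (hv : ∀ l, 0 ≤ (w l).2) (e : Fin n → ℕ)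
    {r : ℚ} (hr : 0 ≤ r) (s : Fin (n + 1) →₀ ℕ) :
    Real.exp (ρr (expo w e r s)) =
      Real.exp (((Mden w e r : ℕ) : ℝ)⁻¹) ^ Aexp w e r s * croot (Mden w e r) ^ Bexp w e r s := by
  rw [xroot_pow_Aexp hu e hr, croot_pow_Bexp hv e hr, ← Real.exp_add, ρr]

/-- **THE `0`-TH CONJUGATE FACTOR AT `x = e^{1/𝔐}` IS THE CLEARED COLLAPSED RELATION**:
`G₀(e^{1/𝔐}) = den(r)^D · F(r)`. -/
theorem eval_Gfac_zero (P : MvPolynomial (Fin (n + 1)) ℤ) {D : ℕ} (hD : ∀ s ∈ P.support, s 0 ≤ D)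
    {w : Fin n → ℚ × ℚ} (hu : ∀ l, 0 ≤ (w l).1) (hv : ∀ l, 0 ≤ (w l).2) (e : Fin n → ℕ) {r : ℚ} (hr : 0 ≤ r) :
    (Gfac (Mden w e r) P.support (coef P D r) (Aexp w e r) (Bexp w e r) 0).eval
        ((Real.exp (((Mden w e r : ℕ) : ℝ)⁻¹) : ℝ) : ℂ) = (r.den : ℂ) ^ D * FR P w e (r : ℝ) := by
  rw [← sum_coef_exp P hD w e r, Gfac, eval_finsetSum]
  refine Finset.sum_congr rfl fun s _ => ?_
  rw [eval_mul, eval_pow, eval_C, eval_X, broot_zero, ρι, ← Complex.ofReal_exp, exp_ρr_expo hu hv e hr s]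
  push_cast; ring

/-- Size of a conjugate factor at `x = e^{1/𝔐}`: every term is at most `|coef_s| · 2^{(expo_s).2} · e^{(expo_s).1}`. -/
theorem norm_eval_Gfac_collapse_le (P : MvPolynomial (Fin (n + 1)) ℤ) (D : ℕ)
    {w : Fin n → ℚ × ℚ} (hu : ∀ l, 0 ≤ (w l).1) (hv : ∀ l, 0 ≤ (w l).2) (e : Fin n → ℕ) {r : ℚ} (hr : 0 ≤ r)
    (i : ℕ) :
    ‖(Gfac (Mden w e r) P.support (coef P D r) (Aexp w e r) (Bexp w e r) i).eval
        ((Real.exp (((Mden w e r : ℕ) : ℝ)⁻¹) : ℝ) : ℂ)‖ ≤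
      ∑ s ∈ P.support, |(coef P D r s : ℝ)| * Real.exp (ρr (expo w e r s)) := by
  refine (norm_eval_Gfac_le (Mden_pos w e r).ne' _ _ _ _ i (Real.exp_pos _).le).trans (le_of_eq ?_)
  refine Finset.sum_congr rfl fun s _ => ?_
  rw [exp_ρr_expo hu hv e hr s]; ring

/-- Height of a conjugate factor: `Σ_s |coef_s| c_𝔐^{B'_s} = Σ_s |coef_s| 2^{(expo_s).2}`. -/
theorem height_Gfac_collapse_eq (P : MvPolynomial (Fin (n + 1)) ℤ) (D : ℕ)
    {w : Fin n → ℚ × ℚ} (hv : ∀ l, 0 ≤ (w l).2) (e : Fin n → ℕ) {r : ℚ} (hr : 0 ≤ r) :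
    ∑ s ∈ P.support, |(coef P D r s : ℝ)| * croot (Mden w e r) ^ Bexp w e r s =
      ∑ s ∈ P.support, |(coef P D r s : ℝ)| * Real.exp (((expo w e r s).2 : ℝ) * Real.log 2) :=
  Finset.sum_congr rfl fun s _ => by rw [croot_pow_Bexp hv e hr]

/-! ### From avoidance at `r` to the hypotheses of `resNorm_ne_zero` -/

/-- The avoidance condition AT the rational point `r`. -/
def AvoidAt (P : MvPolynomial (Fin (n + 1)) ℤ) (w : Fin n → ℚ × ℚ) (e : Fin n → ℕ) (r : ℚ) : Prop :=
  ∀ s ∈ P.support, ∀ s' ∈ P.support, tail s ≠ tail s' →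
    (Δ1 w e (tail s) (tail s')).eval r ≠ 0 ∨ ¬ IsZ ((Δ2 w e (tail s) (tail s')).eval r)

/-- The integral exponents `(A'_s, B'_s)` determine the exponent pair `expo s`. -/
theorem expo_eq_of_Aexp_Bexp_eq {w : Fin n → ℚ × ℚ} (hu : ∀ l, 0 ≤ (w l).1) (hv : ∀ l, 0 ≤ (w l).2)
    (e : Fin n → ℕ) {r : ℚ} (hr : 0 ≤ r) {s s' : Fin (n + 1) →₀ ℕ} (hA : Aexp w e r s = Aexp w e r s')
    (hB : Bexp w e r s = Bexp w e r s') : expo w e r s = expo w e r s' := by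
  have hM : ((Mden w e r : ℕ) : ℚ) ≠ 0 := by exact_mod_cast (Mden_pos w e r).ne'
  have h1 := Aexp_cast hu e hr s
  have h2 := Aexp_cast hu e hr s'
  have h3 := Bexp_cast hv e hr s
  have h4 := Bexp_cast hv e hr s'
  rw [hA] at h1; rw [hB] at h3
  exact Prod.ext (mul_left_cancel₀ hM (h1.symm.trans h2)) (mul_left_cancel₀ hM (h3.symm.trans h4))

/-- Under avoidance at `r`: equal collapsed exponents come from equal exponential parts. -/
theorem tail_eq_of_expo_eq' {P : MvPolynomial (Fin (n + 1)) ℤ} {w : Fin n → ℚ × ℚ} {e : Fin n → ℕ} {r : ℚ}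
    (hav : AvoidAt P w e r) {s s' : Fin (n + 1) →₀ ℕ} (hs : s ∈ P.support) (hs' : s' ∈ P.support)
    (h : expo w e r s = expo w e r s') : tail s = tail s' := by
  by_contra hne
  rcases hav s hs s' hs' hne with h1 | h2
  · exact h1 (by rw [← expo_fst_sub, h, sub_self])
  · exact h2 ⟨0, by rw [← expo_snd_sub, h, sub_self, Int.cast_zero]⟩

/-- Under avoidance at `r`: within an `A'`-fibre the residue `B' mod 𝔐` determines `B'` (hypothesis `hres`). -/
theorem hres_of_avoid {P : MvPolynomial (Fin (n + 1)) ℤ} {w : Fin n → ℚ × ℚ} (hu : ∀ l, 0 ≤ (w l).1)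
    (hv : ∀ l, 0 ≤ (w l).2) {e : Fin n → ℕ} {r : ℚ} (hr : 0 ≤ r) (hav : AvoidAt P w e r)
    {t : Fin (n + 1) →₀ ℕ} (ht : t ∈ P.support) :
    ∀ s ∈ P.support, Aexp w e r s = Aexp w e r t → Bexp w e r s % Mden w e r = Bexp w e r t % Mden w e r →
      Bexp w e r s = Bexp w e r t := by
  intro s hs hA hB
  by_cases hst : tail s = tail t
  · simp only [Bexp, expo_eq_of_tail_eq w e r hst]
  · exfalso
    have hM : ((Mden w e r : ℕ) : ℚ) ≠ 0 := by exact_mod_cast (Mden_pos w e r).ne'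
    rcases hav s hs t ht hst with h1 | h2
    · apply h1
      have ha := Aexp_cast hu e hr s
      have hb := Aexp_cast hu e hr t
      rw [hA] at ha
      rw [← expo_fst_sub, mul_left_cancel₀ hM (ha.symm.trans hb), sub_self]
    · apply h2
      obtain ⟨k, hk⟩ := (Nat.modEq_iff_dvd.mp hB.symm)
      -- `(𝔐 : ℤ) ∣ B'_s − B'_t`... `Nat.ModEq n a b ↔ (n:ℤ) ∣ b - a`; here `hB.symm : B t % M = B s % M`
      refine ⟨k, ?_⟩
      have hs2 := Bexp_cast hv e hr s
      have ht2 := Bexp_cast hv e hr t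
      rw [← expo_snd_sub]
      have hk' : ((Bexp w e r s : ℕ) : ℚ) - ((Bexp w e r t : ℕ) : ℚ) = (Mden w e r : ℚ) * (k : ℚ) := by
        exact_mod_cast hk
      have : (Mden w e r : ℚ) * ((expo w e r s).2 - (expo w e r t).2) = (Mden w e r : ℚ) * (k : ℚ) := by
        rw [mul_sub, ← hs2, ← ht2, hk']
      exact mul_left_cancel₀ hM this

/-- Under avoidance at `r`: the `(A', B')`-cell of `t` in the support is exactly the tail fibre of `t`. -/
theorem cell_eq_fibre {P : MvPolynomial (Fin (n + 1)) ℤ} {w : Fin n → ℚ × ℚ} (hu : ∀ l, 0 ≤ (w l).1)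
    (hv : ∀ l, 0 ≤ (w l).2) {e : Fin n → ℕ} {r : ℚ} (hr : 0 ≤ r) (hav : AvoidAt P w e r)
    {t : Fin (n + 1) →₀ ℕ} (ht : t ∈ P.support) :
    (P.support.filter fun s => Aexp w e r s = Aexp w e r t ∧ Bexp w e r s = Bexp w e r t) =
      P.support.filter fun s => tail s = tail t := by
  ext s
  simp only [Finset.mem_filter, and_congr_right_iff]
  intro hs
  constructor
  · rintro ⟨hA, hB⟩
    exact tail_eq_of_expo_eq' hav hs ht (expo_eq_of_Aexp_Bexp_eq hu hv e hr hA hB)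
  · intro hst
    simp only [Aexp, Bexp, expo_eq_of_tail_eq w e r hst, and_self]

/-- `aeval` at a real point of an integer polynomial, read in `ℂ`. -/
theorem aeval_ofReal_int (p : ℤ[X]) (x : ℝ) : aeval (x : ℂ) p = ((aeval x p : ℝ) : ℂ) := by
  have : (x : ℂ) = algebraMap ℝ ℂ x := rfl
  rw [this, aeval_algebraMap_apply]
  rfl

/-- Under avoidance at `r` and a non-vanishing fibre value: the cell sum of `t` is non-zero (hypothesis `hsum`). -/
theorem hsum_of_avoid (P : MvPolynomial (Fin (n + 1)) ℤ) {D : ℕ} (hD : ∀ s ∈ P.support, s 0 ≤ D)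
    {w : Fin n → ℚ × ℚ} (hu : ∀ l, 0 ≤ (w l).1) (hv : ∀ l, 0 ≤ (w l).2) {e : Fin n → ℕ} {r : ℚ} (hr : 0 ≤ r)
    (hav : AvoidAt P w e r) {t : Fin (n + 1) →₀ ℕ} (ht : t ∈ P.support)
    (hfib : aeval (r : ℝ) (fib P (tail t)) ≠ 0) :
    (∑ s ∈ P.support with (Aexp w e r s = Aexp w e r t ∧ Bexp w e r s = Bexp w e r t), coef P D r s) ≠ 0 := by
  rw [cell_eq_fibre hu hv hr hav ht]
  intro h0
  have h1 := sum_coef_fibre_cast P hD r (tail t)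
  rw [h0, Int.cast_zero] at h1
  have hq : (r.den : ℂ) ^ D ≠ 0 := pow_ne_zero _ (by exact_mod_cast r.den_nz)
  have hfibC : aeval (r : ℂ) (fib P (tail t)) ≠ 0 := by
    rw [← Complex.ofReal_ratCast, aeval_ofReal_int]
    exact_mod_cast hfib
  exact (mul_ne_zero hq hfibC) h1.symm

end Collapse

end Summit.Schanuel.Schanuel.Theorems.RootDecomp1ERadixCell

end
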